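import Summits.AtomisticToContinuum.Crystallization.Theorems.PricedLinkCensusLocalToGlobalPhaseGapDefs

/-!
# Line `phase-gap-rate-upgrade` (crux stmt-AtomisticToContinuum-14232), stub `stub_sparsePricing`:
# normal forms of SPARSE PRICING (lead c12 / wave-1 worker W1; the stub itself is NOT proved here)

The registered stub is `Sub₁ → SparsePricingWith (1/100)` (`Sub₁ = QualitativeChargeGapWith (1/100)`, the qualitative
phase gap).  This file records the elementary structure of its consequent, all by the far-copies device of
`Theorems/ChargedEnergyGap/Negative/FarCopies.lean` (all `[folklore]`):

* `SparsePriceWith η ρ₁ κ C` / `SparsePriceFrom η ρ₁ κ C N₀` — the sparse priced inequality with parameters (threshold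
  `ρ₁`, price `κ`, allowance `C`; the second only for `N ≥ N₀`); `SparsePricingWith η ↔ ∃ ρ₁ κ C, …` by `Iff.rfl`.
* **The class of sparse near-minimisers is closed under far copies**: `M` far translated copies of a `y` with
  `#ch ≤ ρ₁N`, `E ≤ N(e* + ρ₁)` again satisfy both (charge `× M`, energy `≤ M·E(y)`), so the amplification of
  `noBoundaryAt_of_gapWith` runs INSIDE the class: **the allowance `C·N^(2/3)` and any finite-`N` exemption are not
  load-bearing** — `sparsePriceWith_of_from : SparsePriceFrom η ρ₁ κ C N₀ → SparsePriceWith η ρ₁' κ 0` for every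
  `ρ₁' ≤ ρ₁`, `ρ₁' < 1` (`η ≤ 1`; the threshold is capped below `1` only to make the one-point configuration, which has
  no far copies with a readable charge, vacuous), hence
  `sparsePricingWith_iff_noAllowance : SparsePricingWith η ↔ ∃ ρ₁ κ > 0, SparsePriceWith η ρ₁ κ 0` and
  `sparsePricingWith_iff_eventually : SparsePricingWith η ↔ ∃ ρ₁ κ > 0, ∃ C N₀, SparsePriceFrom η ρ₁ κ C N₀`.
* `sparse_not_dense` — **Sub₁ is inert on the sparse class**: a configuration with `#ch ≤ ρ₁N` and `ρN ≤ #ch`,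
  `ρ₁ < ρ`, is empty.  So inside the class the hypothesis of the stub can only be used on OTHER configurations
  (surgery / comparison), never on `y` itself: the stub is the sibling crux `ChargedEnergyGap` (14231) restricted to
  sparse near-minimisers, i.e. a uniform price for dilute 1 %-charge in nearly charge-free, nearly optimal matter.
* `stub_sparsePricing_iff_noAllowance` — the registered stub, read back: `Sub₁ → ∃ ρ₁ κ > 0, SparsePriceWith (1/100) ρ₁ κ 0`.
-/

noncomputable section

namespace Summit.AtomisticToContinuum.Crystallization.Theorems.PricedLinkCensusLocalToGlobalPhaseGap

open Literature.MathematicalPhysics.StatisticalMechanics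
open Literature.Geometry.DiscreteGeometry
open Summit.AtomisticToContinuum.Crystallization.Theses.PricedLinkCensus
open Summit.AtomisticToContinuum.Crystallization.Theorems.ChargedEnergyGapNegative
open scoped BigOperators

/-! ## The sparse priced inequality with parameters -/

/-- **Sparse pricing with parameters**: tolerance `η`, sparsity / near-minimality threshold `ρ₁`, price `κ`,
allowance `C` — every finite injective configuration with `#ch ≤ ρ₁·N` and `E_LJ ≤ N·(e* + ρ₁)` satisfies
`N·e* + κ·#ch − C·N^(2/3) ≤ E_LJ`. [folklore] -/
def SparsePriceWith (η ρ₁ κ C : ℝ) : Prop :=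
  ∀ (N : ℕ) (y : Fin N → E3), Function.Injective y → (charged η y : ℝ) ≤ ρ₁ * (N : ℝ) →
    interactionEnergy lennardJones y ≤ (N : ℝ) * (eStar + ρ₁) →
      (N : ℝ) * eStar + κ * (charged η y : ℝ) - C * (N : ℝ) ^ (2 / 3 : ℝ) ≤ interactionEnergy lennardJones y

/-- The same inequality asserted only for configurations of at least `N₀` points. [folklore] -/
def SparsePriceFrom (η ρ₁ κ C : ℝ) (N₀ : ℕ) : Prop :=
  ∀ (N : ℕ) (y : Fin N → E3), N₀ ≤ N → Function.Injective y → (charged η y : ℝ) ≤ ρ₁ * (N : ℝ) →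
    interactionEnergy lennardJones y ≤ (N : ℝ) * (eStar + ρ₁) →
      (N : ℝ) * eStar + κ * (charged η y : ℝ) - C * (N : ℝ) ^ (2 / 3 : ℝ) ≤ interactionEnergy lennardJones y

/-- `SparsePricingWith η ↔ ∃ ρ₁ κ C, 0 < ρ₁ ∧ 0 < κ ∧ SparsePriceWith η ρ₁ κ C`, by `Iff.rfl`. [folklore] -/
theorem sparsePricingWith_iff_exists (η : ℝ) :
    SparsePricingWith η ↔ ∃ ρ₁ κ C : ℝ, 0 < ρ₁ ∧ 0 < κ ∧ SparsePriceWith η ρ₁ κ C :=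
  Iff.rfl

/-- `SparsePriceFrom … 0` is `SparsePriceWith`. [folklore] -/
theorem sparsePriceFrom_zero_iff (η ρ₁ κ C : ℝ) : SparsePriceFrom η ρ₁ κ C 0 ↔ SparsePriceWith η ρ₁ κ C :=
  ⟨fun h N y hy => h N y (Nat.zero_le N) hy, fun h N y _ hy => h N y hy⟩

/-- `SparsePriceWith` gives `SparsePriceFrom` at every `N₀`. [folklore] -/
theorem SparsePriceWith.from {η ρ₁ κ C : ℝ} (h : SparsePriceWith η ρ₁ κ C) (N₀ : ℕ) :
    SparsePriceFrom η ρ₁ κ C N₀ :=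
  fun N y _ hy => h N y hy

/-- Monotonicity: a smaller threshold `ρ₁' ≤ ρ₁` (smaller class), a smaller price `κ' ≤ κ` and a larger allowance
`C ≤ C'` are all weaker. [folklore] -/
theorem SparsePriceFrom.mono {η ρ₁ ρ₁' κ κ' C C' : ℝ} {N₀ N₀' : ℕ} (h : SparsePriceFrom η ρ₁ κ C N₀)
    (hρ : ρ₁' ≤ ρ₁) (hκ : κ' ≤ κ) (hC : C ≤ C') (hN : N₀ ≤ N₀') : SparsePriceFrom η ρ₁' κ' C' N₀' := by
  intro N y hN' hy hch hE
  have hN0 : (0 : ℝ) ≤ N := Nat.cast_nonneg N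
  have hch' : (charged η y : ℝ) ≤ ρ₁ * (N : ℝ) := hch.trans (mul_le_mul_of_nonneg_right hρ hN0)
  have hE' : interactionEnergy lennardJones y ≤ (N : ℝ) * (eStar + ρ₁) :=
    hE.trans (mul_le_mul_of_nonneg_left (by linarith) hN0)
  have := h N y (hN.trans hN') hy hch' hE'
  have h1 : κ' * (charged η y : ℝ) ≤ κ * (charged η y : ℝ) :=
    mul_le_mul_of_nonneg_right hκ (Nat.cast_nonneg _)
  have h2 : C * (N : ℝ) ^ (2 / 3 : ℝ) ≤ C' * (N : ℝ) ^ (2 / 3 : ℝ) :=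
    mul_le_mul_of_nonneg_right hC (Real.rpow_nonneg hN0 _)
  linarith

/-- Monotonicity of `SparsePriceWith` in `ρ₁`, `κ`, `C`. [folklore] -/
theorem SparsePriceWith.mono {η ρ₁ ρ₁' κ κ' C C' : ℝ} (h : SparsePriceWith η ρ₁ κ C)
    (hρ : ρ₁' ≤ ρ₁) (hκ : κ' ≤ κ) (hC : C ≤ C') : SparsePriceWith η ρ₁' κ' C' :=
  (sparsePriceFrom_zero_iff _ _ _ _).1 (((sparsePriceFrom_zero_iff _ _ _ _).2 h).mono hρ hκ hC le_rfl)

/-! ## Sub₁ is inert on the sparse class -/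

/-- **The phase-gap hypothesis never fires on a sparse configuration**: `#ch ≤ ρ₁·N` and `ρ·N ≤ #ch` with
`ρ₁ < ρ` force `N = 0`.  (So in `Sub₁ → SparsePricing` the hypothesis can only be used on configurations OTHER
than the one being priced.) [folklore] -/
theorem sparse_not_dense {η ρ ρ₁ : ℝ} (hρ : ρ₁ < ρ) {N : ℕ} {y : Fin N → E3}
    (h₁ : (charged η y : ℝ) ≤ ρ₁ * (N : ℝ)) (h₂ : ρ * (N : ℝ) ≤ (charged η y : ℝ)) : N = 0 := by
  by_contra hN
  have hNpos : (0 : ℝ) < N := by exact_mod_cast Nat.pos_of_ne_zero hN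
  nlinarith

/-! ## Far copies stay in the class: no allowance, no finite-`N` exemption -/

/-- **Amplification inside the sparse class.**  If the sparse priced inequality holds with threshold `ρ₁`, price
`κ`, ANY allowance `C` and only for `N ≥ N₀`, then it holds with NO allowance for ALL `N`, at every threshold
`ρ₁' ≤ ρ₁` with `ρ₁' < 1` (tolerance `η ≤ 1`).  Proof: for `N ≥ 2` the `M = m³ ≥ N₀` far translated copies of a
sparse near-minimiser `y` (`copiesFin`, spacing `8D + 8`) are injective, carry `M·#ch(y) ≤ ρ₁·(MN)` charged
sites (`charged_copiesFin`) and have energy `≤ M·E(y) ≤ (MN)(e* + ρ₁)` (`interactionEnergy_copiesFin_le`), so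
the hypothesis prices them; dividing by `m³` kills `C·(m³N)^(2/3)/m³ = C·N^(2/3)/m`.  `N = 0` is trivial and
`N = 1` is not in the class (`#ch = 1 > ρ₁'`). [folklore] -/
theorem sparsePriceWith_of_from {η ρ₁ ρ₁' κ C : ℝ} {N₀ : ℕ} (hη1 : η ≤ 1)
    (h : SparsePriceFrom η ρ₁ κ C N₀) (hρ' : ρ₁' ≤ ρ₁) (hρ1 : ρ₁' < 1) :
    SparsePriceWith η ρ₁' κ 0 := by
  intro N y hy hch hE
  rw [zero_mul, sub_zero]
  have hN0 : (0 : ℝ) ≤ N := Nat.cast_nonneg N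
  rcases Nat.lt_or_ge N 2 with hN2 | hN2
  · interval_cases N
    · rw [charged_zero, interactionEnergy_of_subsingleton]
      simp
    · exfalso
      rw [charged_eq_of_le (by norm_num) y] at hch
      push_cast at hch
      linarith
  · have hN' : ∀ i : Fin N, ∃ j, j ≠ i := exists_ne_of_two_le hN2
    have hNpos : 0 < N := by omega
    -- the class is closed under far copies, so the hypothesis prices `M` copies for every `M ≥ N₀`
    have key : ∀ M : ℕ, N₀ ≤ M → ((M : ℝ) * N) * eStar + κ * ((M : ℝ) * charged η y) -
        C * ((M : ℝ) * N) ^ (2 / 3 : ℝ) ≤ (M : ℝ) * interactionEnergy lennardJones y := by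
      intro M hM
      have hM0 : (0 : ℝ) ≤ M := Nat.cast_nonneg M
      have hMN : N₀ ≤ M * N := hM.trans (Nat.le_mul_of_pos_right M hNpos)
      have hinj := copiesFin_injective M (two_Dsum_lt_spacing y) hy
      have hcop := interactionEnergy_copiesFin_le M y (one_le_spacing_sub y)
      have hchM : (charged η (copiesFin M (spacing y) y) : ℝ) ≤ ρ₁ * ((M * N : ℕ) : ℝ) := by
        rw [charged_copiesFin M hη1 y hN']
        push_cast
        have h1 : (charged η y : ℝ) ≤ ρ₁ * N := hch.trans (mul_le_mul_of_nonneg_right hρ' hN0)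
        have h2 := mul_le_mul_of_nonneg_left h1 hM0
        linarith
      have hEM : interactionEnergy lennardJones (copiesFin M (spacing y) y) ≤
          ((M * N : ℕ) : ℝ) * (eStar + ρ₁) := by
        refine hcop.trans ?_
        push_cast
        have h1 : interactionEnergy lennardJones y ≤ (N : ℝ) * (eStar + ρ₁) :=
          hE.trans (mul_le_mul_of_nonneg_left (by linarith) hN0)
        have h2 := mul_le_mul_of_nonneg_left h1 hM0
        linarith
      have hg := h (M * N) (copiesFin M (spacing y) y) hMN hinj hchM hEM
      rw [charged_copiesFin M hη1 y hN'] at hg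
      push_cast at hg
      exact hg.trans hcop
    -- amplification by `M = m³`
    refine le_of_not_gt fun hlt => ?_
    have hε0 : 0 < (N : ℝ) * eStar + κ * (charged η y : ℝ) - interactionEnergy lennardJones y := by
      linarith
    obtain ⟨m₀, hm₀⟩ := exists_nat_gt (C * (N : ℝ) ^ (2 / 3 : ℝ) /
      ((N : ℝ) * eStar + κ * (charged η y : ℝ) - interactionEnergy lennardJones y))
    obtain ⟨m, hm_gt, hm_ge, hm_one⟩ : ∃ m : ℕ, (m₀ : ℝ) < m ∧ N₀ ≤ m ∧ 1 ≤ m :=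
      ⟨m₀ + 1 + N₀, by push_cast; linarith, by omega, by omega⟩
    have hmpos : (0 : ℝ) < m := by exact_mod_cast hm_one
    have hm1 : C * (N : ℝ) ^ (2 / 3 : ℝ) <
        (m : ℝ) * ((N : ℝ) * eStar + κ * (charged η y : ℝ) - interactionEnergy lennardJones y) := by
      rw [div_lt_iff₀ hε0] at hm₀
      exact hm₀.trans_le (mul_le_mul_of_nonneg_right hm_gt.le hε0.le)
    have hm2 : (0 : ℝ) < (m : ℝ) ^ 2 := pow_pos hmpos 2
    have hN₀m : N₀ ≤ m ^ 3 := hm_ge.trans (Nat.le_self_pow (by norm_num) m)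
    have hkey := key (m ^ 3) hN₀m
    push_cast [Nat.cast_pow] at hkey
    rw [cube_mul_rpow hmpos.le hN0] at hkey
    nlinarith [mul_lt_mul_of_pos_right hm1 hm2, hkey]

/-- In particular the allowance alone is not load-bearing: `SparsePriceWith η ρ₁ κ C → SparsePriceWith η ρ₁' κ 0`
for `ρ₁' ≤ ρ₁`, `ρ₁' < 1`, `η ≤ 1`. [folklore] -/
theorem sparsePriceWith_noAllowance {η ρ₁ ρ₁' κ C : ℝ} (hη1 : η ≤ 1) (h : SparsePriceWith η ρ₁ κ C)
    (hρ' : ρ₁' ≤ ρ₁) (hρ1 : ρ₁' < 1) : SparsePriceWith η ρ₁' κ 0 :=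
  sparsePriceWith_of_from hη1 (h.from 0) hρ' hρ1

/-- **`SparsePricingWith η ↔ ∃ ρ₁ κ > 0, SparsePriceWith η ρ₁ κ 0`** (`η ≤ 1`): provers of the sparse pricing may
drop the boundary allowance `C·N^(2/3)` altogether (and refuters need no boundary bookkeeping). [folklore] -/
theorem sparsePricingWith_iff_noAllowance {η : ℝ} (hη1 : η ≤ 1) :
    SparsePricingWith η ↔ ∃ ρ₁ κ : ℝ, 0 < ρ₁ ∧ 0 < κ ∧ SparsePriceWith η ρ₁ κ 0 := by
  rw [sparsePricingWith_iff_exists]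
  constructor
  · rintro ⟨ρ₁, κ, C, hρ₁, hκ, h⟩
    exact ⟨min ρ₁ (1 / 2), κ, lt_min hρ₁ (by norm_num), hκ,
      sparsePriceWith_noAllowance hη1 h (min_le_left _ _) ((min_le_right _ _).trans_lt (by norm_num))⟩
  · rintro ⟨ρ₁, κ, hρ₁, hκ, h⟩
    exact ⟨ρ₁, κ, 0, hρ₁, hκ, h⟩

/-- **`SparsePricingWith η` need only be proved for large `N`** (`η ≤ 1`):
`SparsePricingWith η ↔ ∃ ρ₁ κ > 0, ∃ C N₀, SparsePriceFrom η ρ₁ κ C N₀`. [folklore] -/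
theorem sparsePricingWith_iff_eventually {η : ℝ} (hη1 : η ≤ 1) :
    SparsePricingWith η ↔ ∃ ρ₁ κ : ℝ, 0 < ρ₁ ∧ 0 < κ ∧ ∃ (C : ℝ) (N₀ : ℕ), SparsePriceFrom η ρ₁ κ C N₀ := by
  rw [sparsePricingWith_iff_exists]
  constructor
  · rintro ⟨ρ₁, κ, C, hρ₁, hκ, h⟩
    exact ⟨ρ₁, κ, hρ₁, hκ, C, 0, h.from 0⟩
  · rintro ⟨ρ₁, κ, hρ₁, hκ, C, N₀, h⟩
    exact ⟨min ρ₁ (1 / 2), κ, 0, lt_min hρ₁ (by norm_num), hκ,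
      sparsePriceWith_of_from hη1 h (min_le_left _ _) ((min_le_right _ _).trans_lt (by norm_num))⟩

/-! ## The registered stub, read back -/

/-- The registered stub `stub_sparsePricing` of the line is `Sub₁ → SparsePricingWith (1/100)` verbatim, hence
equivalent to `Sub₁ → ∃ ρ₁ κ > 0, SparsePriceWith (1/100) ρ₁ κ 0` (no allowance). [folklore] -/
theorem stub_sparsePricing_iff_noAllowance :
    (QualitativeChargeGapWith (1 / 100) → SparsePricingWith (1 / 100)) ↔
      (QualitativeChargeGapWith (1 / 100) → ∃ ρ₁ κ : ℝ, 0 < ρ₁ ∧ 0 < κ ∧ SparsePriceWith (1 / 100) ρ₁ κ 0) :=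
  imp_congr_right fun _ => sparsePricingWith_iff_noAllowance (by norm_num)

/-- With the lossless split of the sibling crux (`chargedEnergyGap_iff_qualitativeChargeGap_and_sparsePricing`):
the stub is `Sub₁ → ChargedEnergyGap`, and under `Sub₁` the crux is exactly the allowance-free sparse pricing.
[folklore] -/
theorem chargedEnergyGap_iff_sparseNoAllowance_of_qualitativeChargeGap (h₁ : QualitativeChargeGapWith (1 / 100)) :
    ChargedEnergyGap ↔ ∃ ρ₁ κ : ℝ, 0 < ρ₁ ∧ 0 < κ ∧ SparsePriceWith (1 / 100) ρ₁ κ 0 := by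
  rw [chargedEnergyGap_iff_qualitativeChargeGap_and_sparsePricing, ← sparsePricingWith_iff_noAllowance (by norm_num)]
  exact ⟨fun h => h.2, fun h => ⟨h₁, h⟩⟩

/-- At the route's tolerance `1/100` (registered on the crux item as the statement this file proves):
`SparsePricingWith (1/100) ↔ ∃ ρ₁ κ > 0, SparsePriceWith (1/100) ρ₁ κ 0` — no boundary allowance is needed.
[folklore] -/
theorem sparsePricing_iff_noAllowance_hundredth : SparsePricingWith (1 / 100) ↔ ∃ ρ₁ κ : ℝ, 0 < ρ₁ ∧ 0 < κ ∧ SparsePriceWith (1 / 100) ρ₁ κ 0 :=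
  sparsePricingWith_iff_noAllowance (by norm_num)

end Summit.AtomisticToContinuum.Crystallization.Theorems.PricedLinkCensusLocalToGlobalPhaseGap

end
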